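import Mathlib

/-!
# Route `FilamentSkeletonRss` · child crux `TangentSkeletonNearStraightL` (stmt-NavierStokesRegularity-23320) · registered line
# `child_tangent_analytic_strip_L` (b0b56c52900dd90a), stub `stub_stripPropagation` — brick: LINEAR ESCAPE OF NEAR-STRAIGHT CURVES

Every Biot–Savart integral along a filament of the stub converges because the filaments escape linearly; in the near-straight regime of the stub
(`‖X′(τ) − X′(σ)‖ ≤ Rb` for ALL `τ, σ`, unit speed) this is elementary and GLOBAL — no use of the single-scale chord–arc clause is needed:
* `inner_ge_of_norm_sub_le` — unit vectors with `‖v − t‖ ≤ Rb` have `⟪v, t⟫ ≥ 1 − Rb²/2`;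
* `chord_ge_of_near_straight` — for a differentiable unit-speed curve with tangent oscillation `≤ Rb`:
  `(1 − Rb²/2)·|σ − σ₀| ≤ ⟪X σ − X σ₀, X′ σ₀⟫·sign = |⟪X σ − X σ₀, X′ σ₀⟫| ≤ ‖X σ − X σ₀‖` (projection on the tangent at `σ₀` grows at rate
  `≥ 1 − Rb²/2`; with `Rb ≤ ½` the rate is `≥ 7/8`).
This is the dominating-function input (R2/R4 of the STUB-PLAN memo attached to 23320) for the holomorphic parametric integrals
(`Literature.Analysis.Complex.HolomorphicParametricIntegral.differentiableOn_integral_of_dominated`).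
HONEST FRAMING: a brick for a plan about a HYPOTHETICAL filament skeleton on the NEGATIVE side of a MODEL route; the stub `stub_stripPropagation` is
NOT closed; nothing here bears on Navier–Stokes regularity or blow-up.  `--supports stmt-NavierStokesRegularity-23320`.
-/

set_option linter.dupNamespace false

noncomputable section

namespace Summit.NavierStokesRegularity.NavierStokesRegularity.Theorems.NearStraightEscape

open Set
open scoped InnerProductSpace

variable {E : Type*} [NormedAddCommGroup E] [InnerProductSpace ℝ E]

/-- Unit vectors at distance `≤ Rb` have inner product `≥ 1 − Rb²/2`. [folklore] -/
theorem inner_ge_of_norm_sub_le {v t : E} {Rb : ℝ} (hv : ‖v‖ = 1) (ht : ‖t‖ = 1) (h : ‖v - t‖ ≤ Rb) :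
    1 - Rb ^ 2 / 2 ≤ ⟪v, t⟫_ℝ := by
  have hRb : 0 ≤ Rb := (norm_nonneg _).trans h
  have hexp : ‖v - t‖ ^ 2 = 2 - 2 * ⟪v, t⟫_ℝ := by
    rw [@norm_sub_sq_real, hv, ht, one_pow]; ring
  have hsq : ‖v - t‖ ^ 2 ≤ Rb ^ 2 := pow_le_pow_left₀ (norm_nonneg _) h 2
  rw [hexp] at hsq
  linarith

/-- **Linear escape of a near-straight unit-speed curve.**  `X : ℝ → E` differentiable, `‖X′‖ = 1`, tangent oscillation
`‖X′(τ) − X′(σ)‖ ≤ Rb` for all `τ, σ`: then `(1 − Rb²/2)·|σ − σ₀| ≤ |⟪X σ − X σ₀, X′ σ₀⟫|` for all `σ, σ₀`. [folklore] -/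
theorem abs_inner_chord_tangent_ge {X : ℝ → E} {Rb : ℝ} (hX : Differentiable ℝ X) (hunit : ∀ τ, ‖deriv X τ‖ = 1)
    (hosc : ∀ τ σ, ‖deriv X τ - deriv X σ‖ ≤ Rb) (σ₀ σ : ℝ) :
    (1 - Rb ^ 2 / 2) * |σ - σ₀| ≤ |⟪X σ - X σ₀, deriv X σ₀⟫_ℝ| := by
  set t : E := deriv X σ₀ with ht
  set g : ℝ → ℝ := fun s => ⟪X s - X σ₀, t⟫_ℝ with hg
  have hgd : ∀ s, HasDerivAt g ⟪deriv X s, t⟫_ℝ s := by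
    intro s
    have h1 : HasDerivAt (fun s => X s - X σ₀) (deriv X s) s := (hX s).hasDerivAt.sub_const _
    have h2 := h1.inner ℝ (hasDerivAt_const s t)
    simpa using h2
  have hgdiff : Differentiable ℝ g := fun s => (hgd s).differentiableAt
  have hg' : ∀ s, 1 - Rb ^ 2 / 2 ≤ deriv g s := by
    intro s
    rw [(hgd s).deriv]
    exact inner_ge_of_norm_sub_le (hunit s) (hunit σ₀) (hosc s σ₀)
  have hg0 : g σ₀ = 0 := by simp [hg]
  rcases le_total σ₀ σ with hle | hle
  · have h := mul_sub_le_image_sub_of_le_deriv hgdiff hg' hle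
    rw [hg0, sub_zero] at h
    rw [abs_of_nonneg (sub_nonneg.2 hle)]
    exact h.trans (le_abs_self _)
  · have h := mul_sub_le_image_sub_of_le_deriv hgdiff hg' hle
    rw [hg0, zero_sub] at h
    rw [abs_of_nonpos (sub_nonpos.2 hle)]
    have h' : (1 - Rb ^ 2 / 2) * -(σ - σ₀) ≤ -g σ := by linarith
    exact h'.trans (neg_le_abs _)

/-- **Chord bound.**  Under the same hypotheses `(1 − Rb²/2)·|σ − σ₀| ≤ ‖X σ − X σ₀‖`; in the stub's regime `Rb ≤ ½` this is
`(7/8)·|σ − σ₀| ≤ ‖X σ − X σ₀‖`. [folklore] -/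
theorem chord_ge_of_near_straight {X : ℝ → E} {Rb : ℝ} (hX : Differentiable ℝ X) (hunit : ∀ τ, ‖deriv X τ‖ = 1)
    (hosc : ∀ τ σ, ‖deriv X τ - deriv X σ‖ ≤ Rb) (σ₀ σ : ℝ) :
    (1 - Rb ^ 2 / 2) * |σ - σ₀| ≤ ‖X σ - X σ₀‖ := by
  have h := abs_inner_chord_tangent_ge hX hunit hosc σ₀ σ
  have hcs : |⟪X σ - X σ₀, deriv X σ₀⟫_ℝ| ≤ ‖X σ - X σ₀‖ := by
    have := abs_real_inner_le_norm (X σ - X σ₀) (deriv X σ₀)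
    rw [hunit σ₀, mul_one] at this
    exact this
  exact h.trans hcs

/-- The stub's regime: `Rb ≤ ½` gives the escape rate `7/8`. [folklore] -/
theorem chord_ge_seven_eighths {X : ℝ → E} {Rb : ℝ} (hX : Differentiable ℝ X) (hunit : ∀ τ, ‖deriv X τ‖ = 1)
    (hosc : ∀ τ σ, ‖deriv X τ - deriv X σ‖ ≤ Rb) (hRb : Rb ≤ 1 / 2) (σ₀ σ : ℝ) :
    7 / 8 * |σ - σ₀| ≤ ‖X σ - X σ₀‖ := by
  have hRb0 : 0 ≤ Rb := (norm_nonneg _).trans (hosc σ₀ σ₀)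
  have h := chord_ge_of_near_straight hX hunit hosc σ₀ σ
  have hc : 7 / 8 ≤ 1 - Rb ^ 2 / 2 := by nlinarith
  exact (mul_le_mul_of_nonneg_right hc (abs_nonneg _)).trans h

end Summit.NavierStokesRegularity.NavierStokesRegularity.Theorems.NearStraightEscape

end
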